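import Literature.IUT.HodgeArakelov.ThetaSettingCompletionPackageGeomIdent
import Literature.AnabelianGeometry.EtaleTheta.SettingModelTatePairKernelNontrivial
import HarnessLib

/-!
# (H1) «`Δ ⊆ Π` characteristic» at the stage-2 [EtTh] Tate model — UNCONDITIONAL (no binder):
# the K-L6 custody input (H1)/MChar of the Cor. 1.12 (ii)(iii) instance of record is a kernel theorem at the model

S. Mochizuki, *Inter-universal Teichmüller theory II*, §1, Example 1.8 (i) (kurims p. 35): "the subgroup `Δ ⊆ Π` [...] may be
characterized group-theoretically" [claim: Mochizuki2012, status: disputed]; [AbsTopI] Thm 2.6 (iv)/(v) p. 22, Thm 1.7 (ii) p. 14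
[cite: MochizukiAbsTopI2012, Thm 2.6 (v) p.22].

Cell `abc-iut`, seat abc-iut-w4-d044 (gen 7): CAPSTONE of the row chain «MCHAR-VIA-PROJECTIVITY» (abc-iut-w6-d055 p472470/p473904 — the
elasticity dichotomy and the centralising-subgroup route; this seat's (H′) theorem p481105/p481457, assembly p483847, model instantiation
p485127/p485565, identification p486362, and `SettingModel.ker_tatePairHom_ne_bot` — the last classical binder «`I_χ ≠ 1`» discharged by
elasticity + slimness of `G_{ℚ_p}`).  PROOF-ONLY, two one-line theorems, 0 defs.

WHAT IS SHOWN — at `D := ThetaSetting.modelχq p i j` (every `i j`), for EVERY `X̲̲`-choice `C` and its [IUTchII] §1 setting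
`S := ThetaSetting.ofDoubleUnderline C μ …` / `EtaleLevels.setting C … mods f hf`:
**every automorphism of topological groups of `Π^{(S)} = C.Huu` carries `Δ^{(S)}` onto itself** — `SettingModel.deltaX_characteristic_
ofDoubleUnderline_modelχq_holds`, `SettingModel.deltaX_characteristic_setting_modelχq_holds` (the latter is EXACTLY the type of the
binder `hΔX` of `ModelTateCarriers.cor112_model_modelTate_section_translates`, p477403, at `(i, j) = (1, 2)`).
K-L6: the custody input (H1)/MChar (abc-iut-w4-d043 p466815 `hΔX ⟺ MChar`) is DISCHARGED at the stage-2 Tate model with NO residual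
hypothesis; the Cor. 1.12 (ii)(iii) instance of record keeps the ∀-binders {`hP`, `h218i₁` = F-0620@1, `hcharY` = F-2633@instance, `huniq`, `G`}.

HONEST FRAMING: `modelχq` is a SEMI-SYNTHETIC model (binder-discharge / joint-satisfiability evidence for OUR typed interface, not the
tempered `π₁` of a curve); classical profinite group theory + the tree's theorems on the genuine `G_{ℚ_p}`; nothing here bears on
[IUTchIII] Cor. 3.12 or takes a side; typed ≠ proved elsewhere; instantiated ≠ endorsed; nothing asserts abc proved or refuted.
-/

noncomputable section

namespace Literature.AnabelianGeometry.EtaleTheta.SettingModel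

open Literature.IUT.HodgeArakelov

variable (p : ℕ) [Fact p.Prime] (i j : ℤ) (hj : Even j)

section Model

variable {ED : (ThetaSetting.modelχq p i j hj).EtaleThetaData} {l : ℕ} (C : ED.DoubleUnderline l) {N : ℕ+}
  (μ : (ThetaSetting.modelχq p i j hj).CyclotomeMod l N) (hC : (ThetaSetting.modelχq p i j hj).Compat)
  (hS : (ThetaSetting.modelχq p i j hj).Sec2Hyps) (hl : l.Prime) (hp2 : p ≠ 2) (hpl : p ≠ l)
  (hζ : ∃ ζ : (ThetaSetting.modelχq p i j hj).K, IsPrimitiveRoot ζ (4 * l))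
  {η : (C.thetaEnvData μ hC hS).PiYdd → MuN p N} (hη : η ∈ (C.thetaEnvData μ hC hS).thetaCocycles)

/-- **(H1) at the stage-2 Tate model, UNCONDITIONAL**: for every `X̲̲`-choice `C` over `modelχq p i j` and `S := ofDoubleUnderline C μ …`,
every automorphism of topological groups of `Π^{(S)}` carries `Δ^{(S)}` onto itself.
[claim: Mochizuki2012, status: disputed] (IUTchII §1 Ex 1.8 (i), kurims p.35) [cite: MochizukiAbsTopI2012, Thm 2.6 (v) p.22] -/
theorem deltaX_characteristic_ofDoubleUnderline_modelχq_holds :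
    ∀ φ : (ThetaSetting.ofDoubleUnderline C μ hC hS hl hp2 hpl hζ hη).PiX ≃ₜ*
        (ThetaSetting.ofDoubleUnderline C μ hC hS hl hp2 hpl hζ hη).PiX,
      (ThetaSetting.ofDoubleUnderline C μ hC hS hl hp2 hpl hζ hη).DeltaX.map φ.toMulEquiv.toMonoidHom =
        (ThetaSetting.ofDoubleUnderline C μ hC hS hl hp2 hpl hζ hη).DeltaX :=
  deltaX_characteristic_ofDoubleUnderline_modelχq_of_ker_ne_bot' p i j hj C μ hC hS hl hp2 hpl hζ hη
    (ker_tatePairHom_ne_bot p i j)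

/-- **The `hΔX` binder of the Cor. 1.12 (ii)(iii) instance of record p477403, SUPPLIED with NO residual**: (H1) at
`EtaleLevels.setting C hC hS hl hp2 hpl hζ mods f hf` over `modelχq p i j`.  Consumer term at `(i, j) = (1, 2)`:
`cor112_model_modelTate_section_translates … (deltaX_characteristic_setting_modelχq_holds p 1 2 even_two C hC hS hlp hp2 hpl hζ τ.modAll f hf) G`.
[claim: Mochizuki2012, status: disputed] (IUTchII §1 Ex 1.8 (i), kurims p.35) [cite: MochizukiAbsTopI2012, Thm 2.6 (v) p.22] -/
theorem deltaX_characteristic_setting_modelχq_holds (mods : ∀ M : ℕ+, (ThetaSetting.modelχq p i j hj).CyclotomeMod l M)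
    (f : _) (hf : f ∈ C.rootCocycles hC) :
    ∀ φ : (EtaleLevels.setting C hC hS hl hp2 hpl hζ mods f hf).PiX ≃ₜ* (EtaleLevels.setting C hC hS hl hp2 hpl hζ mods f hf).PiX,
      (EtaleLevels.setting C hC hS hl hp2 hpl hζ mods f hf).DeltaX.map φ.toMulEquiv.toMonoidHom =
        (EtaleLevels.setting C hC hS hl hp2 hpl hζ mods f hf).DeltaX :=
  deltaX_characteristic_setting_modelχq_of_ker_ne_bot' p i j hj C hC hS hl hp2 hpl hζ mods f hf (ker_tatePairHom_ne_bot p i j)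

end Model

end Literature.AnabelianGeometry.EtaleTheta.SettingModel

end
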